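import Mathlib
import Literature.MathematicalPhysics.StatisticalMechanics.Crystallization
import Literature.MathematicalPhysics.StatisticalMechanics.LennardJonesClusters

/-!
# Packing estimates for the dense-centres stub of `HcpDiffractionRigidity`
# (item `stmt-AtomisticToContinuum-13166`, stub `stub_denseCentres`, Aux file 2)

Elementary geometric inputs, for a finite `δ`-separated configuration `y` in `ℝ³`:

* `sum_exp_le` — Gaussian shell sums: `∑ₗ e^{-π|yₗ-yₖ|²/s²} ≤ 2(2/δ+1)³ s³` for `s ≥ 1`
  (shells of width `s` hold `≤ ((n+1)s)³(2/δ+1)³` points by the volume packing bound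
  `card_le_of_separated_of_dist_le`, and `(n+1)³ e^{-π n} ≤ 2^{-n}`);
* `exists_pos_le_norm_of_dual` — the vectors `k ≠ 0` with `⟨k, g⟩ ∈ ℤ` for all `g` in a full
  lattice have norm bounded below (pair `k` with a lattice basis of `ℝ³`);
* `card_mul_volume_le_integral` — if a nonnegative integrable `f` is `≥ c` on the disjoint balls
  `B(yᵢ, ρ)`, `i ∈ B`, then `#B · vol(B_ρ) · c ≤ ∫ f`;
* `quarter_le_kernelSum` — at a particle with few neighbours at scale `b√2`, the two-scale kernel
  sum `∑ₖ (G_a - (a/b)³ G_b)(z - yₖ)` is `≥ 1/4` on the ball `B(yⱼ, ρ)` (self term of `G_a`);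
* `exists_cutoff` — a continuous cutoff `χ ∈ [0,1]`, `= 1` on `η ≤ |ξ| ≤ r/4`, supported in
  `η/2 ≤ |ξ| ≤ r/2` (product of two smooth bumps);
* `exists_scale` — a scale `a ≥ 1` with `a⁶ e^{-πa²r²/16} K ≤ γ` (`u³e^{-u} → 0`).

All `[folklore]`.
-/

noncomputable section

namespace Summit.AtomisticToContinuum.Crystallization.Theorems

namespace HcpRigidityDenseCentres

open MeasureTheory Metric Filter
open scoped BigOperators Real RealInnerProductSpace Topology
open Literature.MathematicalPhysics.StatisticalMechanics

local notation "E3" => EuclideanSpace ℝ (Fin 3)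

/-! ## Gaussian shell sums -/

/-- `e^{-π} ≤ 1/16`. [folklore] -/
theorem exp_neg_pi_le : Real.exp (-Real.pi) ≤ 1 / 16 := by
  have h1 := Real.exp_one_gt_d9
  have h3 : Real.exp 3 = Real.exp 1 ^ 3 := by
    rw [← Real.exp_nat_mul]; norm_num
  have h16 : (16 : ℝ) ≤ Real.exp Real.pi :=
    calc (16 : ℝ) ≤ 2.7182818283 ^ 3 := by norm_num
      _ ≤ Real.exp 1 ^ 3 := by gcongr
      _ = Real.exp 3 := h3.symm
      _ ≤ Real.exp Real.pi := Real.exp_le_exp.2 (by linarith [Real.pi_gt_three])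
  rw [Real.exp_neg, one_div]
  exact inv_anti₀ (by norm_num) h16

/-- `(n+1)³ e^{-π n} ≤ 2^{-n}`. [folklore] -/
theorem cube_mul_exp_le (n : ℕ) :
    ((n : ℝ) + 1) ^ 3 * Real.exp (-Real.pi) ^ n ≤ (1 / 2) ^ n := by
  have h1 : ((n : ℝ) + 1) ^ 3 ≤ 8 ^ n := by
    have h : (n : ℝ) + 1 ≤ 2 ^ n := by exact_mod_cast Nat.lt_two_pow_self
    calc ((n : ℝ) + 1) ^ 3 ≤ (2 ^ n) ^ 3 := by gcongr
      _ = 8 ^ n := by rw [← pow_mul, mul_comm, pow_mul]; norm_num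
  have h2 : Real.exp (-Real.pi) ^ n ≤ (1 / 16) ^ n :=
    pow_le_pow_left₀ (Real.exp_pos _).le exp_neg_pi_le n
  calc ((n : ℝ) + 1) ^ 3 * Real.exp (-Real.pi) ^ n ≤ 8 ^ n * (1 / 16) ^ n := by
        gcongr
    _ = (1 / 2) ^ n := by rw [← mul_pow]; norm_num

/-- **Gaussian shell sums.** For a `δ`-separated finite configuration `y` in `ℝ³`, a particle `k`
and a scale `s ≥ 1`, `∑ₗ e^{-π|yₗ - yₖ|²/s²} ≤ 2 (2/δ + 1)³ s³`. [folklore] -/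
theorem sum_exp_le {N : ℕ} (y : Fin N → E3) {δ : ℝ} (hδ : 0 < δ)
    (hsep : ∀ i j : Fin N, i ≠ j → δ ≤ dist (y i) (y j)) (k : Fin N) {s : ℝ} (hs : 1 ≤ s) :
    ∑ l, Real.exp (-(Real.pi / s ^ 2) * ‖y l - y k‖ ^ 2) ≤ 2 * (2 / δ + 1) ^ 3 * s ^ 3 := by
  classical
  have hs0 : 0 < s := by linarith
  set m : Fin N → ℕ := fun l => ⌊‖y l - y k‖ / s⌋₊ with hm
  set t : Finset ℕ := Finset.univ.image m with ht
  have hmaps : ∀ l ∈ (Finset.univ : Finset (Fin N)), m l ∈ t := fun l _ =>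
    Finset.mem_image_of_mem m (Finset.mem_univ l)
  -- bound on one shell
  have hfib : ∀ n ∈ t, ∑ l ∈ Finset.univ.filter (fun l => m l = n),
      Real.exp (-(Real.pi / s ^ 2) * ‖y l - y k‖ ^ 2) ≤ (2 / δ + 1) ^ 3 * s ^ 3 * (1 / 2) ^ n := by
    intro n _
    set S := Finset.univ.filter (fun l => m l = n) with hS
    -- each term is at most `e^{-π n}`
    have hterm : ∀ l ∈ S, Real.exp (-(Real.pi / s ^ 2) * ‖y l - y k‖ ^ 2) ≤
        Real.exp (-Real.pi) ^ n := by
      intro l hl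
      rw [hS, Finset.mem_filter] at hl
      have hfl : (n : ℝ) ≤ ‖y l - y k‖ / s := by
        rw [← hl.2]; exact Nat.floor_le (by positivity)
      rw [← Real.exp_nat_mul, Real.exp_le_exp]
      have h1 : (n : ℝ) ≤ (n : ℝ) ^ 2 := by
        rcases Nat.eq_zero_or_pos n with h0 | h0
        · simp [h0]
        · have : (1 : ℝ) ≤ n := by exact_mod_cast h0
          nlinarith
      have h2 : (n : ℝ) ^ 2 ≤ (‖y l - y k‖ / s) ^ 2 := pow_le_pow_left₀ (Nat.cast_nonneg n) hfl 2
      rw [div_pow] at h2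
      have h3 : Real.pi / s ^ 2 * ‖y l - y k‖ ^ 2 = Real.pi * (‖y l - y k‖ ^ 2 / s ^ 2) := by ring
      rw [neg_mul, h3]
      nlinarith [Real.pi_pos]
    -- the shell holds at most `((n+1)s)³ (2/δ+1)³` points
    have hcard : (S.card : ℝ) ≤ ((n : ℝ) + 1) ^ 3 * s ^ 3 * (2 / δ + 1) ^ 3 := by
      have hinj : Set.InjOn y S := by
        intro i _ j _ hij
        by_contra hne
        have := hsep i j hne
        rw [hij, dist_self] at this
        linarith
      rw [← Finset.card_image_of_injOn hinj]
      have hR : (0 : ℝ) ≤ (n + 1) * s := by positivity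
      have hpack := card_le_of_separated_of_dist_le (S.image y) (y k) hδ hR ?_ ?_
      rotate_left
      · intro p hp
        rw [Finset.mem_image] at hp
        obtain ⟨l, hl, rfl⟩ := hp
        rw [hS, Finset.mem_filter] at hl
        have h1 := Nat.lt_floor_add_one (‖y l - y k‖ / s)
        rw [show ⌊‖y l - y k‖ / s⌋₊ = n from hl.2, div_lt_iff₀ hs0] at h1
        rw [dist_eq_norm]
        exact h1.le
      · intro p hp q hq hpq
        rw [Finset.mem_image] at hp hq
        obtain ⟨i, -, rfl⟩ := hp
        obtain ⟨j, -, rfl⟩ := hq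
        exact hsep i j fun h => hpq (by rw [h])
      have hfr : Module.finrank ℝ E3 = 3 := by simp
      rw [hfr] at hpack
      refine hpack.trans ?_
      have hns : (1 : ℝ) ≤ (n + 1) * s := by nlinarith [(Nat.cast_nonneg n : (0 : ℝ) ≤ n)]
      have hle : 2 * ((n + 1) * s) / δ + 1 ≤ (n + 1) * s * (2 / δ + 1) := by
        rw [mul_add, mul_one]
        have : 2 * ((n + 1) * s) / δ = (n + 1) * s * (2 / δ) := by ring
        rw [this]
        gcongr
      calc (2 * (((n : ℝ) + 1) * s) / δ + 1) ^ 3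
          ≤ ((n + 1) * s * (2 / δ + 1)) ^ 3 := by gcongr
        _ = ((n : ℝ) + 1) ^ 3 * s ^ 3 * (2 / δ + 1) ^ 3 := by ring
    calc ∑ l ∈ S, Real.exp (-(Real.pi / s ^ 2) * ‖y l - y k‖ ^ 2)
        ≤ ∑ l ∈ S, Real.exp (-Real.pi) ^ n := Finset.sum_le_sum hterm
      _ = (S.card : ℝ) * Real.exp (-Real.pi) ^ n := by rw [Finset.sum_const, nsmul_eq_mul]
      _ ≤ ((n : ℝ) + 1) ^ 3 * s ^ 3 * (2 / δ + 1) ^ 3 * Real.exp (-Real.pi) ^ n := by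
          gcongr
      _ = (2 / δ + 1) ^ 3 * s ^ 3 * (((n : ℝ) + 1) ^ 3 * Real.exp (-Real.pi) ^ n) := by ring
      _ ≤ (2 / δ + 1) ^ 3 * s ^ 3 * (1 / 2) ^ n := by gcongr; exact cube_mul_exp_le n
  have hgeom : ∑ n ∈ t, ((1 : ℝ) / 2) ^ n ≤ 2 := by
    have h := (summable_geometric_two).sum_le_tsum t fun n _ => by positivity
    rwa [tsum_geometric_two] at h
  calc ∑ l, Real.exp (-(Real.pi / s ^ 2) * ‖y l - y k‖ ^ 2)
      = ∑ n ∈ t, ∑ l ∈ Finset.univ.filter (fun l => m l = n),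
          Real.exp (-(Real.pi / s ^ 2) * ‖y l - y k‖ ^ 2) :=
        (Finset.sum_fiberwise_of_maps_to hmaps _).symm
    _ ≤ ∑ n ∈ t, (2 / δ + 1) ^ 3 * s ^ 3 * (1 / 2) ^ n := Finset.sum_le_sum hfib
    _ = (2 / δ + 1) ^ 3 * s ^ 3 * ∑ n ∈ t, (1 / 2 : ℝ) ^ n := by rw [Finset.mul_sum]
    _ ≤ (2 / δ + 1) ^ 3 * s ^ 3 * 2 := by gcongr
    _ = 2 * (2 / δ + 1) ^ 3 * s ^ 3 := by ring

/-! ## The first Bragg radius -/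

/-- **First Bragg radius.** For a full lattice `G ⊂ ℝ³`, the non-zero vectors `k` with
`⟨k, g⟩ ∈ ℤ` for all `g ∈ G` have norm `≥ r` for some `r > 0` (pair `k` with a `ℤ`-basis of `G`,
which is an `ℝ`-basis of `ℝ³`). [folklore] -/
theorem exists_pos_le_norm_of_dual (P : PeriodicConfiguration 3) :
    ∃ r : ℝ, 0 < r ∧ ∀ k : E3, (∀ g ∈ P.lattice, ∃ n : ℤ, ⟪k, g⟫ = (n : ℝ)) → k ≠ 0 → r ≤ ‖k‖ := by
  haveI : Module.Finite ℤ P.lattice := ZLattice.module_finite ℝ P.lattice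
  haveI : Module.Free ℤ P.lattice := ZLattice.module_free ℝ P.lattice
  set b₀ := Module.Free.chooseBasis ℤ P.lattice with hb₀
  set b := b₀.ofZLatticeBasis ℝ P.lattice with hb
  set S : ℝ := ∑ i, ‖b i‖ with hSdef
  have hS : 0 ≤ S := Finset.sum_nonneg fun i _ => norm_nonneg _
  refine ⟨1 / (S + 1), by positivity, fun k hk hk0 => ?_⟩
  by_contra hlt
  rw [not_le] at hlt
  apply hk0
  -- all pairings with the basis vectors vanish
  have h0 : ∀ i, ⟪k, b i⟫ = 0 := by
    intro i
    have hbi : (b i : E3) ∈ P.lattice := by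
      rw [hb, Module.Basis.ofZLatticeBasis_apply]; exact (b₀ i).2
    obtain ⟨n, hn⟩ := hk (b i) hbi
    have hni : ‖b i‖ ≤ S := by
      rw [hSdef]
      exact Finset.single_le_sum (fun j _ => norm_nonneg (b j)) (Finset.mem_univ i)
    have habs : |(n : ℝ)| < 1 := by
      rw [← hn]
      calc |⟪k, b i⟫| ≤ ‖k‖ * ‖b i‖ := abs_real_inner_le_norm _ _
        _ ≤ 1 / (S + 1) * S := mul_le_mul hlt.le hni (norm_nonneg _) (by positivity)
        _ < 1 := by rw [div_mul_eq_mul_div, one_mul, div_lt_one (by positivity)]; linarith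
    have hn0 : n = 0 := by
      rw [← Int.abs_lt_one_iff]; exact_mod_cast habs
    rw [hn, hn0, Int.cast_zero]
  -- hence `k = 0`
  have hkk : ⟪k, ∑ i, b.repr k i • b i⟫ = 0 := by
    rw [inner_sum]
    exact Finset.sum_eq_zero fun i _ => by rw [inner_smul_right, h0 i, mul_zero]
  rw [b.sum_repr k] at hkk
  exact inner_self_eq_zero.1 hkk

/-! ## Integrals over disjoint balls -/

/-- If a nonnegative integrable `f` is `≥ c` on the balls `B(yᵢ, ρ)`, `i ∈ B`, with centres at
mutual distances `≥ 2ρ`, then `#B · vol(B_ρ) · c ≤ ∫ f`. [folklore] -/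
theorem card_mul_volume_le_integral {N : ℕ} (y : Fin N → E3) (B : Finset (Fin N)) {ρ : ℝ}
    (hdisj : ∀ i ∈ B, ∀ j ∈ B, i ≠ j → ρ + ρ ≤ dist (y i) (y j))
    {f : E3 → ℝ} (hf : Integrable f) (hf0 : ∀ z, 0 ≤ f z) {c : ℝ}
    (hfc : ∀ i ∈ B, ∀ z ∈ ball (y i) ρ, c ≤ f z) :
    (B.card : ℝ) * (volume (ball (0 : E3) ρ)).toReal * c ≤ ∫ z, f z := by
  classical
  set U : Set E3 := ⋃ i ∈ B, ball (y i) ρ with hU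
  have hUm : MeasurableSet U :=
    Finset.measurableSet_biUnion B fun i _ => measurableSet_ball
  have hPD : (B : Set (Fin N)).PairwiseDisjoint fun i => ball (y i) ρ := by
    intro i hi j hj hij
    exact ball_disjoint_ball (hdisj i hi j hj hij)
  have hvolU : volume U = ∑ i ∈ B, volume (ball (y i) ρ) :=
    measure_biUnion_finset hPD fun i _ => measurableSet_ball
  have hball : ∀ i, volume (ball (y i) ρ) = volume (ball (0 : E3) ρ) := fun i =>
    Measure.addHaar_ball_center volume (y i) ρ
  simp_rw [hball, Finset.sum_const, nsmul_eq_mul] at hvolU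
  have hUfin : volume U ≠ ⊤ := by
    rw [hvolU]; exact ENNReal.mul_ne_top (ENNReal.natCast_ne_top _) measure_ball_lt_top.ne
  have hcU : ∀ z ∈ U, c ≤ f z := by
    intro z hz
    rw [hU, Set.mem_iUnion₂] at hz
    obtain ⟨i, hi, hz⟩ := hz
    exact hfc i hi z hz
  have h1 := setIntegral_ge_of_const_le hUm hUfin hcU hf.integrableOn
  have h2 := setIntegral_le_integral (s := U) hf (ae_of_all _ hf0)
  rw [measureReal_def, hvolU, ENNReal.toReal_mul, ENNReal.toReal_natCast, smul_eq_mul] at h1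
  linarith

/-! ## The two-scale kernel near a sparse particle -/

/-- `e^{1/4} ≤ 2`. [folklore] -/
theorem exp_quarter_le_two : Real.exp (1 / 4 : ℝ) ≤ 2 := by
  have h := Real.add_one_le_exp (-(1 / 4 : ℝ))
  rw [Real.exp_neg] at h
  have hpos := Real.exp_pos (1 / 4 : ℝ)
  have h34 : (3 / 4 : ℝ) ≤ (Real.exp (1 / 4))⁻¹ := by linarith
  rw [le_inv_comm₀ (by norm_num) hpos] at h34
  linarith [show ((3 / 4 : ℝ))⁻¹ = 4 / 3 by norm_num]

/-- **The two-scale kernel near a sparse particle.** If the Gaussian mass of particle `j` at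
scale `b√2` is at most `(b/a)³/8`, then on the ball `B(yⱼ, ρ)` (`ρ ≤ 1/4`, `1 ≤ a`, `1 ≤ b`) the
kernel sum `∑ₖ (e^{-π|z-yₖ|²/a²} - (a/b)³ e^{-π|z-yₖ|²/b²})` is `≥ 1/4` (the self term of the first
Gaussian is `≥ 1/2`, the second sum is `≤ 2 ·` the mass at scale `b√2`). [folklore] -/
theorem quarter_le_kernelSum {N : ℕ} (y : Fin N → E3) {a b ρ : ℝ} (ha : 1 ≤ a) (hb : 1 ≤ b)
    (hρ : ρ ≤ 1 / 4) (j : Fin N)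
    (hbad : ∑ k, Real.exp (-(Real.pi / (2 * b ^ 2)) * ‖y k - y j‖ ^ 2) ≤ (b / a) ^ 3 / 8)
    (z : E3) (hz : z ∈ ball (y j) ρ) :
    1 / 4 ≤ ∑ k, (Real.exp (-(Real.pi / a ^ 2) * ‖z - y k‖ ^ 2) -
      (a / b) ^ 3 * Real.exp (-(Real.pi / b ^ 2) * ‖z - y k‖ ^ 2)) := by
  have ha0 : 0 < a := by linarith
  have hb0 : 0 < b := by linarith
  rw [mem_ball, dist_eq_norm] at hz
  have hz2 : ‖z - y j‖ ^ 2 ≤ 1 / 16 := by nlinarith [norm_nonneg (z - y j)]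
  have hpi := Real.pi_le_four
  have hpi0 := Real.pi_pos
  rw [Finset.sum_sub_distrib, ← Finset.mul_sum]
  -- the self term
  have hself : 1 / 2 ≤ ∑ k, Real.exp (-(Real.pi / a ^ 2) * ‖z - y k‖ ^ 2) := by
    have hpa : Real.pi / a ^ 2 ≤ 4 := by
      rw [div_le_iff₀ (by positivity)]; nlinarith
    have hqa : 0 < Real.pi / a ^ 2 := by positivity
    have h1 : 1 / 2 ≤ Real.exp (-(Real.pi / a ^ 2) * ‖z - y j‖ ^ 2) := by
      have : -(1 / 4 : ℝ) ≤ -(Real.pi / a ^ 2) * ‖z - y j‖ ^ 2 := by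
        nlinarith [mul_le_mul hpa hz2 (sq_nonneg _) (by norm_num : (0 : ℝ) ≤ 4)]
      calc (1 / 2 : ℝ) ≤ -(1 / 4 : ℝ) + 1 := by norm_num
        _ ≤ Real.exp (-(1 / 4)) := Real.add_one_le_exp _
        _ ≤ _ := Real.exp_le_exp.2 this
    exact h1.trans (Finset.single_le_sum
      (f := fun k => Real.exp (-(Real.pi / a ^ 2) * ‖z - y k‖ ^ 2))
      (fun k _ => (Real.exp_pos _).le) (Finset.mem_univ j))
  -- the `b`-terms
  have hother : ∑ k, Real.exp (-(Real.pi / b ^ 2) * ‖z - y k‖ ^ 2) ≤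
      2 * ∑ k, Real.exp (-(Real.pi / (2 * b ^ 2)) * ‖y k - y j‖ ^ 2) := by
    rw [Finset.mul_sum]
    refine Finset.sum_le_sum fun k _ => ?_
    have hpar : ‖y k - y j‖ ^ 2 ≤ 2 * ‖z - y k‖ ^ 2 + 2 * ‖z - y j‖ ^ 2 := by
      have : y k - y j = (z - y j) - (z - y k) := by abel
      rw [this]
      have h1 : ‖(z - y j) - (z - y k)‖ ≤ ‖z - y j‖ + ‖z - y k‖ := norm_sub_le _ _
      have h2 : ‖(z - y j) - (z - y k)‖ ^ 2 ≤ (‖z - y j‖ + ‖z - y k‖) ^ 2 :=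
        pow_le_pow_left₀ (norm_nonneg _) h1 2
      nlinarith [sq_nonneg (‖z - y j‖ - ‖z - y k‖)]
    set q : ℝ := Real.pi / b ^ 2 with hq
    have hq0 : 0 < q := by positivity
    have hq4 : q ≤ 4 := by rw [hq, div_le_iff₀ (by positivity)]; nlinarith
    have hq2 : Real.pi / (2 * b ^ 2) = q / 2 := by rw [hq]; field_simp
    rw [hq2]
    have hbnd : -q * ‖z - y k‖ ^ 2 ≤ -(q / 2) * ‖y k - y j‖ ^ 2 + 1 / 4 := by
      have h1 := mul_le_mul_of_nonneg_left hpar (half_pos hq0).le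
      have h2 := mul_le_mul hq4 hz2 (sq_nonneg _) (by norm_num : (0 : ℝ) ≤ 4)
      nlinarith
    calc Real.exp (-q * ‖z - y k‖ ^ 2) ≤ Real.exp (-(q / 2) * ‖y k - y j‖ ^ 2 + 1 / 4) :=
          Real.exp_le_exp.2 hbnd
      _ = Real.exp (-(q / 2) * ‖y k - y j‖ ^ 2) * Real.exp (1 / 4) := Real.exp_add _ _
      _ ≤ Real.exp (-(q / 2) * ‖y k - y j‖ ^ 2) * 2 := by gcongr; exact exp_quarter_le_two
      _ = 2 * Real.exp (-(q / 2) * ‖y k - y j‖ ^ 2) := by ring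
  have hk3 : (a / b) ^ 3 * (2 * ((b / a) ^ 3 / 8)) = 1 / 4 := by field_simp; ring
  have hab0 : 0 ≤ (a / b) ^ 3 := by positivity
  nlinarith [mul_le_mul_of_nonneg_left (hother.trans (by linarith : 2 * ∑ k,
    Real.exp (-(Real.pi / (2 * b ^ 2)) * ‖y k - y j‖ ^ 2) ≤ 2 * ((b / a) ^ 3 / 8))) hab0]

/-! ## The admissible cutoff -/

/-- **A radial cutoff.** For `η, r > 0` there is a continuous compactly supported
`χ : ℝ³ → [0,1]` with `χ = 1` on `η ≤ |ξ| ≤ r/4` and `tsupport χ ⊆ {η/2 ≤ |ξ| ≤ r/2}`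
(a product of two smooth bump functions). [folklore] -/
theorem exists_cutoff {η r : ℝ} (hη : 0 < η) (hr : 0 < r) :
    ∃ χ : E3 → ℝ, Continuous χ ∧ HasCompactSupport χ ∧ (∀ ξ, 0 ≤ χ ξ ∧ χ ξ ≤ 1) ∧
      (∀ ξ : E3, η ≤ ‖ξ‖ → ‖ξ‖ ≤ r / 4 → χ ξ = 1) ∧
      (∀ ξ ∈ tsupport χ, η / 2 ≤ ‖ξ‖ ∧ ‖ξ‖ ≤ r / 2) := by
  let φo : ContDiffBump (0 : E3) := ⟨r / 4, r / 2, by positivity, by linarith⟩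
  let φi : ContDiffBump (0 : E3) := ⟨η / 2, η, by positivity, by linarith⟩
  refine ⟨fun ξ => (1 - φi ξ) * φo ξ, ?_, ?_, ?_, ?_, ?_⟩
  · exact (continuous_const.sub φi.continuous).mul φo.continuous
  · exact φo.hasCompactSupport.mul_left
  · intro ξ
    have h1 := φi.nonneg (x := ξ)
    have h2 := φi.le_one (x := ξ)
    have h3 := φo.nonneg (x := ξ)
    have h4 := φo.le_one (x := ξ)
    exact ⟨mul_nonneg (by linarith) h3, by nlinarith⟩
  · intro ξ hη' hr'
    have ho : φo ξ = 1 := φo.one_of_mem_closedBall (by simpa using hr')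
    have hi : φi ξ = 0 := φi.zero_of_le_dist (by simpa using hη')
    simp [ho, hi]
  · intro ξ hξ
    constructor
    · have hsub : tsupport (fun ξ => (1 - φi ξ) * φo ξ) ⊆ (ball (0 : E3) (η / 2))ᶜ := by
        refine closure_minimal (fun ζ hζ => ?_) isOpen_ball.isClosed_compl
        rw [Set.mem_compl_iff, mem_ball, dist_zero_right, not_lt]
        by_contra h'
        rw [not_le] at h'
        apply hζ
        have h1 : φi ζ = 1 := φi.one_of_mem_closedBall (by simpa using h'.le)
        simp [h1]
      have := hsub hξ
      rw [Set.mem_compl_iff, mem_ball, dist_zero_right, not_lt] at this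
      exact this
    · have h2 : tsupport (fun ξ => (1 - φi ξ) * φo ξ) ⊆ tsupport φo := tsupport_mul_subset_right
      have := h2 hξ
      rw [φo.tsupport_eq, mem_closedBall, dist_zero_right] at this
      exact this

/-! ## Choice of the inner scale -/

/-- Choice of the inner scale: `a ≥ 1` with `a⁶ e^{-πa²r²/16} K ≤ γ`. [folklore] -/
theorem exists_scale {r K γ : ℝ} (hr : 0 < r) (hγ : 0 < γ) :
    ∃ a : ℝ, 1 ≤ a ∧ a ^ 6 * Real.exp (-(Real.pi * a ^ 2 * r ^ 2 / 16)) * K ≤ γ := by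
  set c : ℝ := Real.pi * r ^ 2 / 16 with hc
  have hc0 : 0 < c := by positivity
  -- `u ↦ u³ e^{-u} → 0`, `a ↦ c a² → ∞`
  have hu : Tendsto (fun a : ℝ => c * a ^ 2) atTop atTop :=
    Tendsto.const_mul_atTop hc0 (tendsto_pow_atTop two_ne_zero)
  have h0 := ((Real.tendsto_pow_mul_exp_neg_atTop_nhds_zero 3).comp hu).mul_const (c⁻¹ ^ 3 * K)
  rw [zero_mul] at h0
  have hev := (h0.eventually_lt_const hγ).and (eventually_ge_atTop (1 : ℝ))
  obtain ⟨a, ha, ha1⟩ := hev.exists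
  refine ⟨a, ha1, le_of_lt ?_⟩
  convert ha using 1
  simp only [Function.comp_apply]
  rw [hc]
  field_simp

end HcpRigidityDenseCentres

/-- **Registered helper stub of `stub_denseCentres` (Aux file 2): Gaussian shell sums.** For a
`δ`-separated finite configuration in `ℝ³` and `s ≥ 1`, `∑ₗ e^{-π|yₗ-yₖ|²/s²} ≤ 2(2/δ+1)³ s³`.
[folklore] -/
theorem stub_denseCentresShellSum : ∀ (N : ℕ) (y : Fin N → EuclideanSpace ℝ (Fin 3)) (δ : ℝ), 0 < δ → (∀ i j : Fin N, i ≠ j → δ ≤ dist (y i) (y j)) → ∀ (k : Fin N) (s : ℝ), 1 ≤ s → ∑ l : Fin N, Real.exp (-(Real.pi / s ^ 2) * ‖y l - y k‖ ^ 2) ≤ 2 * (2 / δ + 1) ^ 3 * s ^ 3 :=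
  fun _ y _ hδ hsep k _ hs => HcpRigidityDenseCentres.sum_exp_le y hδ hsep k hs

end Summit.AtomisticToContinuum.Crystallization.Theorems

end
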